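import Mathlib.MeasureTheory.Measure.Decomposition.IntegralRNDeriv
import Literature.Barriers.AnomalousDissipation.CodimensionOneRigidityVariation
import Literature.Barriers.AnomalousDissipation.CodimensionOneRigidityFunctional
import Literature.Barriers.AnomalousDissipation.CodimensionOneRigiditySmoothing
import HarnessLib

/-!
# The `BV` structure theorem on `T^d`: the matrix density of `Du` and its vanishing trace

Support file for the discharge of the named fact
`Literature.Barriers.AnomalousDissipation.DeRosaInversi2024_thm12` (`CodimensionOneRigidity.lean`):
the structure step of De Rosa–Inversi 2024, §4 ("we have used the Radon–Nikodym theorem to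
decompose the matrix-valued measure `∇u(·,t)` with respect to its variation … Since `div u = 0`
we deduce `tr M(·,t) = 0` for `|∇u(·,t)|`-a.e. `x`, for a.e. `t`", display (4.1)), in the form
consumed by the rest of the proof (`exists_density`):

for a bounded strongly measurable field `w : ℝ → T^d → ℝ^d` with
`∫⁻_{[a,b]} |Dw(t)|(T^d) dt < ∞` and `div w(t) = 0` weakly for a.e. `t ∈ [a,b]`, and a continuous
time cut-off `ζ` supported in `[a,b]` with `|ζ| ≤ 1`, there are a finite Borel measure `μ` on
`ℝ × T^d` and a bounded strongly measurable field of trace-free matrices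
`M : ℝ × T^d → (ℝ^d →L ℝ^d)` (trace-free `μ`-a.e.) such that for every smooth space–time `φ`
vanishing outside a compact time interval and all `e, z ∈ ℝ^d`,
`-∫∫ ζ(t) ⟪e, w⟫ Dφ(t,x) z dx dt = ∫ φ ⟪e, M z⟫ dμ`,
i.e. `ζ ∂ⱼwᵢ = Mᵢⱼ μ` as space–time distributions.

Construction: the pairings `φ ↦ -∫∫ ζ wᵢ ∂ⱼφ` are bounded by `sup|φ| ∫⁻|Dw(t)|`
(`enorm_integral_integral_le`), extend by uniform density of smooth functions
(`exists_smooth_near`) to bounded functionals on `C_c(ℝ × T^d)`, which are differences of finite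
Riesz measures (`exists_measure_sub_measure_of_bounded`); `μ` is the sum of all of them and
`Mᵢⱼ` the (truncated) Radon–Nikodym densities (Mathlib `Measure.rnDeriv`,
`integral_rnDeriv_smul`). The trace vanishes by `div w = 0` and the du Bois-Reymond lemma
`ae_eq_zero_of_forall_smooth_integral_eq_zero`. Everything is proved; theorems only.

## References

* L. De Rosa, M. Inversi, Comm. Math. Phys. 405 (2024), §2.2, §4, (4.1) (arXiv:2307.09189).
* L. Ambrosio, N. Fusco, D. Pallara, *Functions of Bounded Variation* (2000), §1.1, §3.1.
-/

noncomputable section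

open MeasureTheory TopologicalSpace Set Function Filter Topology CompactlySupported
open scoped ENNReal NNReal RealInnerProductSpace ContDiff

namespace Literature.Barriers.AnomalousDissipation

namespace CodimensionOneRigidity

open Literature.Analysis Literature.Analysis.FunctionSpaces Literature.Analysis.FluidPDE

variable {d : Type} [Fintype d] [DecidableEq d]

/-! ### Smooth space–time functions: slices, continuity, bounds -/

section Smooth

variable {φ : ℝ → UnitAddTorus d → ℝ}

omit [DecidableEq d] in
/-- Slices of a smooth space–time function are smooth. [folklore] -/
theorem isSmooth_slice (hφ : ContDiff ℝ ∞ (Torus.stLift φ)) (t : ℝ) : Torus.IsSmooth (φ t) :=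
  hφ.comp (contDiff_prodMk_right t)

omit [DecidableEq d] in
/-- Sums of smooth space–time functions are smooth (the lift is additive). [folklore] -/
theorem contDiff_stLift_add {ψ : ℝ → UnitAddTorus d → ℝ} (hφ : ContDiff ℝ ∞ (Torus.stLift φ))
    (hψ : ContDiff ℝ ∞ (Torus.stLift ψ)) : ContDiff ℝ ∞ (Torus.stLift (φ + ψ)) := by
  have h : Torus.stLift (φ + ψ) = fun p => Torus.stLift φ p + Torus.stLift ψ p := rfl
  rw [h]
  exact hφ.add hψ

omit [DecidableEq d] in
/-- Differences of smooth space–time functions are smooth. [folklore] -/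
theorem contDiff_stLift_sub {ψ : ℝ → UnitAddTorus d → ℝ} (hφ : ContDiff ℝ ∞ (Torus.stLift φ))
    (hψ : ContDiff ℝ ∞ (Torus.stLift ψ)) : ContDiff ℝ ∞ (Torus.stLift (φ - ψ)) := by
  have h : Torus.stLift (φ - ψ) = fun p => Torus.stLift φ p - Torus.stLift ψ p := rfl
  rw [h]
  exact hφ.sub hψ

omit [DecidableEq d] in
/-- Scalar multiples of smooth space–time functions are smooth. [folklore] -/
theorem contDiff_stLift_smul (hφ : ContDiff ℝ ∞ (Torus.stLift φ)) (c : ℝ) :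
    ContDiff ℝ ∞ (Torus.stLift (c • φ)) := by
  have h : Torus.stLift (c • φ) = fun p => c • Torus.stLift φ p := rfl
  rw [h]
  exact hφ.const_smul c

/-- The spatial partial derivatives of a smooth space–time function are jointly continuous. [folklore] -/
theorem continuous_uncurry_partialDeriv (hφ : ContDiff ℝ ∞ (Torus.stLift φ)) (j : d) :
    Continuous (uncurry fun t x => Torus.partialDeriv j (φ t) x) := by
  have h := ((Torus.isSmoothSpaceTimeOn_of_contDiff hφ univ).partialDeriv uniqueDiffOn_univ
    j).continuousOn_stLift
  rw [univ_prod_univ, continuousOn_univ] at h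
  exact Torus.continuous_uncurry_of_continuous_stLift h

/-- The spatial partial derivatives of a smooth space–time function are bounded on
`[a, b] × T^d`. [folklore] -/
theorem exists_partialDeriv_le (hφ : ContDiff ℝ ∞ (Torus.stLift φ)) (j : d) (a b : ℝ) :
    ∃ C : ℝ, ∀ t ∈ Icc a b, ∀ x, ‖Torus.partialDeriv j (φ t) x‖ ≤ C :=
  ((Torus.isSmoothSpaceTimeOn_of_contDiff hφ univ).partialDeriv uniqueDiffOn_univ
    j).exists_norm_le_of_isCompact isCompact_Icc (subset_univ _)

omit [DecidableEq d] in
/-- A smooth space–time function is bounded on `[a, b] × T^d` by a positive constant. [folklore] -/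
theorem exists_pos_abs_le (hφ : ContDiff ℝ ∞ (Torus.stLift φ)) (a b : ℝ) :
    ∃ S : ℝ, 0 < S ∧ ∀ t ∈ Icc a b, ∀ x, |φ t x| ≤ S := by
  obtain ⟨C, hC⟩ := (Torus.isSmoothSpaceTimeOn_of_contDiff hφ univ).exists_norm_le_of_isCompact
    isCompact_Icc (subset_univ _)
  refine ⟨max C 1, lt_max_of_lt_right one_pos, fun t ht x => ?_⟩
  rw [← Real.norm_eq_abs]
  exact (hC t ht x).trans (le_max_left _ _)

omit [DecidableEq d] in
/-- A smooth space–time function vanishing outside a compact time interval, as an element of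
`C_c(ℝ × T^d, ℝ)`. [folklore] -/
theorem exists_compactlySupported_eq (hφ : ContDiff ℝ ∞ (Torus.stLift φ)) {a b : ℝ}
    (hab : ∀ t ∉ Icc a b, φ t = 0) :
    ∃ f : C_c(ℝ × UnitAddTorus d, ℝ), ∀ q, f q = φ q.1 q.2 := by
  obtain ⟨hc, -⟩ := continuous_uncurry_and_bounded hφ hab
  have hcs : HasCompactSupport (uncurry φ) := by
    refine HasCompactSupport.intro' (K := Icc a b ×ˢ (univ : Set (UnitAddTorus d)))
      (isCompact_Icc.prod isCompact_univ) (isClosed_Icc.prod isClosed_univ) fun q hq => ?_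
    have ht : q.1 ∉ Icc a b := fun h => hq ⟨h, mem_univ _⟩
    simp [uncurry, hab q.1 ht]
  exact ⟨⟨⟨uncurry φ, hc⟩, hcs⟩, fun q => rfl⟩

end Smooth

/-! ### The pairings `φ ↦ -∫∫ ζ wᵢ ∂ⱼφ`: integrability, linearity, bound -/

section Pairing

variable {w : ℝ → UnitAddTorus d → EuclideanSpace ℝ d} {Mbd : ℝ} {ζ : ℝ → ℝ} {a b : ℝ}

omit [Fintype d] [DecidableEq d] in
/-- Slices of a jointly strongly measurable field are strongly measurable. [folklore] -/
theorem stronglyMeasurable_slice (hw : StronglyMeasurable (uncurry w)) (t : ℝ) :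
    StronglyMeasurable (w t) :=
  hw.comp_measurable measurable_prodMk_left

/-- Integrability in space of `ζ(t) wᵢ ∂ⱼφ(t)` at every time. [folklore] -/
theorem integrable_pairing_slice (hw : StronglyMeasurable (uncurry w)) (hwb : ∀ t x, ‖w t x‖ ≤ Mbd)
    {φ : ℝ → UnitAddTorus d → ℝ} (hφ : ContDiff ℝ ∞ (Torus.stLift φ)) (i j : d) (t : ℝ) :
    Integrable (fun x => ζ t * (w t x i * Torus.partialDeriv j (φ t) x)) volume := by
  refine Integrable.const_mul ?_ _
  refine Integrable.bdd_mul (c := Mbd) ?_ ?_ (ae_of_all _ fun x => ?_)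
  · exact ((isSmooth_slice hφ t).partialDeriv j).continuous.integrable_unitAddTorus
  · exact ((EuclideanSpace.proj i).continuous.comp_stronglyMeasurable
      (stronglyMeasurable_slice hw t)).aestronglyMeasurable
  · rw [Real.norm_eq_abs]
    exact (Torus.abs_apply_le_norm _ _).trans (hwb t x)

/-- The space integrand `(t, x) ↦ wᵢ ∂ⱼφ` is jointly strongly measurable. [folklore] -/
theorem stronglyMeasurable_uncurry_pairing (hw : StronglyMeasurable (uncurry w))
    {φ : ℝ → UnitAddTorus d → ℝ} (hφ : ContDiff ℝ ∞ (Torus.stLift φ)) (i j : d) :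
    StronglyMeasurable (uncurry fun t x => w t x i * Torus.partialDeriv j (φ t) x) := by
  have h1 : StronglyMeasurable fun q : ℝ × UnitAddTorus d => (uncurry w q) i :=
    (EuclideanSpace.proj i).continuous.comp_stronglyMeasurable hw
  exact h1.mul (continuous_uncurry_partialDeriv hφ j).stronglyMeasurable

/-- Integrability in time of `t ↦ ∫ ζ(t) wᵢ ∂ⱼφ(t) dx` for a continuous cut-off supported in
`[a, b]`. [folklore] -/
theorem integrable_pairing_time (hw : StronglyMeasurable (uncurry w)) (hwb : ∀ t x, ‖w t x‖ ≤ Mbd)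
    (hζc : Continuous ζ) (hζ1 : ∀ t, |ζ t| ≤ 1) (hζ0 : ∀ t ∉ Icc a b, ζ t = 0)
    {φ : ℝ → UnitAddTorus d → ℝ} (hφ : ContDiff ℝ ∞ (Torus.stLift φ)) (i j : d) :
    Integrable (fun t => ∫ x, ζ t * (w t x i * Torus.partialDeriv j (φ t) x)) volume := by
  obtain ⟨C, hC⟩ := exists_partialDeriv_le hφ j a b
  have hMbd : 0 ≤ Mbd := (norm_nonneg _).trans (hwb 0 0)
  have hmeas : StronglyMeasurable fun t => ∫ x, ζ t * (w t x i * Torus.partialDeriv j (φ t) x) := by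
    have h := (stronglyMeasurable_uncurry_pairing hw hφ i j).integral_prod_right'
      (ν := (volume : Measure (UnitAddTorus d)))
    have : (fun t => ∫ x, ζ t * (w t x i * Torus.partialDeriv j (φ t) x)) =
        fun t => ζ t * ∫ x, w t x i * Torus.partialDeriv j (φ t) x := by
      funext t
      exact integral_const_mul _ _
    rw [this]
    exact hζc.stronglyMeasurable.mul h
  refine IntegrableOn.integrable_of_forall_notMem_eq_zero (s := Icc a b) ?_ fun t ht => ?_
  · refine IntegrableOn.of_bound measure_Icc_lt_top hmeas.aestronglyMeasurable.restrict
      (Mbd * C) ?_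
    filter_upwards [ae_restrict_mem measurableSet_Icc] with t ht
    rw [integral_const_mul, norm_mul]
    calc ‖ζ t‖ * ‖∫ x, w t x i * Torus.partialDeriv j (φ t) x‖
        ≤ 1 * (Mbd * C) := by
          refine mul_le_mul ?_ ?_ (norm_nonneg _) zero_le_one
          · rw [Real.norm_eq_abs]; exact hζ1 t
          · refine (norm_integral_le_integral_norm _).trans ?_
            calc ∫ x, ‖w t x i * Torus.partialDeriv j (φ t) x‖
                ≤ ∫ x, Mbd * C ∂(volume : Measure (UnitAddTorus d)) := by
                  refine integral_mono_of_nonneg (ae_of_all _ fun x => norm_nonneg _)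
                    (integrable_const _) (ae_of_all _ fun x => ?_)
                  dsimp only
                  rw [norm_mul]
                  refine mul_le_mul ?_ (hC t ht x) (norm_nonneg _) hMbd
                  rw [Real.norm_eq_abs]
                  exact (Torus.abs_apply_le_norm _ _).trans (hwb t x)
              _ = Mbd * C := by simp
      _ = Mbd * C := one_mul _
  · rw [hζ0 t ht]
    simp

/-- **Additivity of the pairing** in the test function. [folklore] -/
theorem pairing_add (hw : StronglyMeasurable (uncurry w)) (hwb : ∀ t x, ‖w t x‖ ≤ Mbd)
    (hζc : Continuous ζ) (hζ1 : ∀ t, |ζ t| ≤ 1) (hζ0 : ∀ t ∉ Icc a b, ζ t = 0)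
    {φ ψ : ℝ → UnitAddTorus d → ℝ} (hφ : ContDiff ℝ ∞ (Torus.stLift φ))
    (hψ : ContDiff ℝ ∞ (Torus.stLift ψ)) (i j : d) :
    (∫ t, ∫ x, ζ t * (w t x i * Torus.partialDeriv j ((φ + ψ) t) x)) =
      (∫ t, ∫ x, ζ t * (w t x i * Torus.partialDeriv j (φ t) x)) +
        ∫ t, ∫ x, ζ t * (w t x i * Torus.partialDeriv j (ψ t) x) := by
  rw [← integral_add (integrable_pairing_time hw hwb hζc hζ1 hζ0 hφ i j)
    (integrable_pairing_time hw hwb hζc hζ1 hζ0 hψ i j)]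
  refine integral_congr_ae (ae_of_all _ fun t => ?_)
  dsimp only
  rw [← integral_add (integrable_pairing_slice hw hwb hφ i j t)
    (integrable_pairing_slice hw hwb hψ i j t)]
  refine integral_congr_ae (ae_of_all _ fun x => ?_)
  dsimp only
  rw [Pi.add_apply, Torus.partialDeriv_add ((isSmooth_slice hφ t).isContDiff (by simp))
    ((isSmooth_slice hψ t).isContDiff (by simp))]
  simp only [Pi.add_apply]
  ring

/-- **Homogeneity of the pairing** in the test function. [folklore] -/
theorem pairing_smul {φ : ℝ → UnitAddTorus d → ℝ} (hφ : ContDiff ℝ ∞ (Torus.stLift φ)) (c : ℝ)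
    (i j : d) :
    (∫ t, ∫ x, ζ t * (w t x i * Torus.partialDeriv j ((c • φ) t) x)) =
      c * ∫ t, ∫ x, ζ t * (w t x i * Torus.partialDeriv j (φ t) x) := by
  rw [← integral_const_mul]
  refine integral_congr_ae (ae_of_all _ fun t => ?_)
  dsimp only
  rw [← integral_const_mul]
  refine integral_congr_ae (ae_of_all _ fun x => ?_)
  dsimp only
  rw [Pi.smul_apply, Torus.partialDeriv_const_smul ((isSmooth_slice hφ t).isContDiff (by simp))]
  simp only [Pi.smul_apply, smul_eq_mul]
  ring

/-- **The `BV` bound of the pairing**: `|∫∫ ζ wᵢ ∂ⱼφ| ≤ S (∫⁻_{[a,b]} |Dw(t)|).toReal` whenever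
`|φ| ≤ S` on `[a, b] × T^d` (`enorm_integral_integral_le`). [cite: DeRosaInversi2024, §4] -/
theorem abs_pairing_le (w : ℝ → UnitAddTorus d → EuclideanSpace ℝ d)
    (hζ1 : ∀ t, |ζ t| ≤ 1) (hζ0 : ∀ t ∉ Icc a b, ζ t = 0)
    (hBV : ∫⁻ t in Icc a b, torusTotalVariation (w t) ≠ ⊤)
    {φ : ℝ → UnitAddTorus d → ℝ} (hφ : ContDiff ℝ ∞ (Torus.stLift φ)) {S : ℝ} (hS : 0 < S)
    (hφS : ∀ t ∈ Icc a b, ∀ x, |φ t x| ≤ S) (i j : d) :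
    |∫ t, ∫ x, ζ t * (w t x i * Torus.partialDeriv j (φ t) x)| ≤
      S * (∫⁻ t in Icc a b, torusTotalVariation (w t)).toReal := by
  have h := enorm_integral_integral_le w hζ1 hζ0 (fun t => isSmooth_slice hφ t) hS hφS i j
  rw [← Real.norm_eq_abs, ← toReal_enorm, ← ENNReal.toReal_ofReal hS.le, ← ENNReal.toReal_mul]
  exact ENNReal.toReal_mono (ENNReal.mul_ne_top ENNReal.ofReal_ne_top hBV) h

end Pairing

/-! ### Expansion of `⟪e, w⟫ Dφ z` in coordinates -/

/-- `ζ ⟪e, w⟫ (Dφ(x) z) = ∑_{i,j} eᵢ zⱼ · ζ wᵢ ∂ⱼφ(x)` for a `C¹` slice `φ`. [folklore] -/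
theorem mul_inner_mul_fderiv_eq_sum {θ : UnitAddTorus d → ℝ} (hθ : Torus.IsContDiff 1 θ) (c : ℝ)
    (v e z : EuclideanSpace ℝ d) (x : UnitAddTorus d) :
    c * (⟪e, v⟫ * Torus.fderiv θ x z) =
      ∑ p : d × d, (e p.1 * z p.2) * (c * (v p.1 * Torus.partialDeriv p.2 θ x)) := by
  have hinner : ⟪e, v⟫ = ∑ i, e i * v i := by
    rw [PiLp.inner_apply]
    refine Finset.sum_congr rfl fun i _ => ?_
    simp [mul_comm]
  rw [Torus.fderiv_apply_eq_sum_partialDeriv hθ, hinner, Fintype.sum_prod_type]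
  simp only [smul_eq_mul]
  show c * ((∑ i, e i * v i) * ∑ j, z j * Torus.partialDeriv j θ x) =
    ∑ i, ∑ j, (e i * z j) * (c * (v i * Torus.partialDeriv j θ x))
  rw [Finset.sum_mul_sum, Finset.mul_sum]
  refine Finset.sum_congr rfl fun i _ => ?_
  rw [Finset.mul_sum]
  refine Finset.sum_congr rfl fun j _ => ?_
  ring

/-- `⟪w, ∇θ⟫ = ∑ᵢ wᵢ ∂ᵢθ` for a `C¹` scalar `θ`. [folklore] -/
theorem inner_gradient_eq_sum {θ : UnitAddTorus d → ℝ} (hθ : Torus.IsContDiff 1 θ)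
    (v : EuclideanSpace ℝ d) (x : UnitAddTorus d) :
    ⟪v, Torus.gradient θ x⟫ = ∑ i, v i * Torus.partialDeriv i θ x := by
  rw [Torus.gradient_eq_sum_partialDeriv hθ, inner_sum]
  refine Finset.sum_congr rfl fun i _ => ?_
  rw [real_inner_smul_right, EuclideanSpace.inner_single_right]
  simp [mul_comm]

/-! ### The elementary matrices `Eᵢⱼ z = zⱼ eᵢ` -/

/-- `⟪e, Eᵢⱼ z⟫ = eᵢ zⱼ` for `Eᵢⱼ = (proj j).smulRight eᵢ`. [folklore] -/
theorem inner_smulRight_single_apply (i j : d) (e z : EuclideanSpace ℝ d) :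
    ⟪e, ((EuclideanSpace.proj j).smulRight (EuclideanSpace.single i (1 : ℝ)) :
      EuclideanSpace ℝ d →L[ℝ] EuclideanSpace ℝ d) z⟫ = e i * z j := by
  rw [ContinuousLinearMap.smulRight_apply, real_inner_smul_right,
    EuclideanSpace.inner_single_right]
  simp [mul_comm]

/-- `‖Eᵢⱼ‖ ≤ 1`. [folklore] -/
theorem norm_smulRight_single_le (i j : d) :
    ‖((EuclideanSpace.proj j).smulRight (EuclideanSpace.single i (1 : ℝ)) :
      EuclideanSpace ℝ d →L[ℝ] EuclideanSpace ℝ d)‖ ≤ 1 := by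
  refine ContinuousLinearMap.opNorm_le_bound _ zero_le_one fun z => ?_
  have h1 : ‖EuclideanSpace.single i (1 : ℝ)‖ = 1 := by simp
  rw [ContinuousLinearMap.smulRight_apply, norm_smul, h1, mul_one, one_mul]
  exact le_trans (le_of_eq (by simp)) (Torus.abs_apply_le_norm z j)

/-- `tr Eᵢⱼ = δᵢⱼ` in the form `tr (∑ mᵢⱼ Eᵢⱼ) = ∑ᵢ mᵢᵢ`. [folklore] -/
theorem trace_sum_smul_smulRight (m : d × d → ℝ)
    (A : EuclideanSpace ℝ d →L[ℝ] EuclideanSpace ℝ d)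
    (hA : A = ∑ p : d × d, m p • ((EuclideanSpace.proj p.2).smulRight
        (EuclideanSpace.single p.1 (1 : ℝ)) : EuclideanSpace ℝ d →L[ℝ] EuclideanSpace ℝ d)) :
    LinearMap.trace ℝ (EuclideanSpace ℝ d) (A : EuclideanSpace ℝ d →ₗ[ℝ] EuclideanSpace ℝ d) =
      ∑ i, m (i, i) := by
  rw [LinearMap.trace_eq_sum_inner _ (EuclideanSpace.basisFun d ℝ)]
  refine Finset.sum_congr rfl fun k _ => ?_
  rw [ContinuousLinearMap.coe_coe, hA, _root_.sum_apply, inner_sum,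
    Fintype.sum_prod_type]
  simp only [FunLike.coe_smul, Pi.smul_apply, real_inner_smul_right,
    EuclideanSpace.basisFun_apply, inner_smulRight_single_apply, PiLp.single_apply]
  simp [Finset.sum_ite_eq', mul_comm]

/-! ### The structure theorem -/

/-- **Structure of `L¹_t BV_x ∩ L^∞` divergence-free fields** (De Rosa–Inversi 2024, §4, (4.1);
the torus version of "`∂ⱼuᵢ = Mᵢⱼ |∇u|`, `tr M = 0` `|∇u|`-a.e. by `div u = 0`", with `|∇u|`
replaced by any finite measure `μ` dominating the Riesz measures of the pairings and with the time
cut-off `ζ` folded in). Let `w : ℝ → T^d → ℝ^d` be strongly measurable and bounded,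
`∫⁻_{[a,b]} |Dw(t)|(T^d) dt < ∞`, `div w(t) = 0` weakly for a.e. `t ∈ [a, b]`, and let `ζ` be a
continuous cut-off supported in `[a, b]` with `|ζ| ≤ 1`. Then there exist a finite measure `μ` on
`ℝ × T^d` and a strongly measurable matrix field `M` with `‖M‖ ≤ (card d)²` and `tr M = 0`
`μ`-a.e. such that `-∫∫ ζ ⟪e, w⟫ (Dφ z) dx dt = ∫ φ ⟪e, M z⟫ dμ` for every smooth space–time `φ`
vanishing outside a compact time interval and all `e, z`. [cite: DeRosaInversi2024, §4 (4.1)] -/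
theorem exists_density {w : ℝ → UnitAddTorus d → EuclideanSpace ℝ d} {Mbd : ℝ}
    (hw : StronglyMeasurable (uncurry w)) (hwb : ∀ t x, ‖w t x‖ ≤ Mbd) {a b : ℝ} {ζ : ℝ → ℝ}
    (hζc : Continuous ζ) (hζ1 : ∀ t, |ζ t| ≤ 1) (hζ0 : ∀ t ∉ Icc a b, ζ t = 0)
    (hBV : ∫⁻ t in Icc a b, torusTotalVariation (w t) ≠ ⊤)
    (hdiv : ∀ᵐ t ∂(volume.restrict (Icc a b)), Torus.IsWeaklyDivFree (w t)) :
    ∃ (μ : Measure (ℝ × UnitAddTorus d))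
      (M : ℝ × UnitAddTorus d → EuclideanSpace ℝ d →L[ℝ] EuclideanSpace ℝ d),
      IsFiniteMeasure μ ∧ StronglyMeasurable M ∧ (∀ q, ‖M q‖ ≤ (Fintype.card d : ℝ) ^ 2) ∧
      (∀ᵐ q ∂μ, LinearMap.trace ℝ (EuclideanSpace ℝ d)
        (M q : EuclideanSpace ℝ d →ₗ[ℝ] EuclideanSpace ℝ d) = 0) ∧
      ∀ φ : ℝ → UnitAddTorus d → ℝ, ContDiff ℝ ∞ (Torus.stLift φ) →
        (∃ a' b' : ℝ, ∀ t ∉ Icc a' b', φ t = 0) → ∀ e z : EuclideanSpace ℝ d,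
          -∫ t, ∫ x, ζ t * (⟪e, w t x⟫ * Torus.fderiv (φ t) x z) =
            ∫ q, φ q.1 q.2 * ⟪e, M q z⟫ ∂μ := by
  classical
  set V : ℝ := (∫⁻ t in Icc a b, torusTotalVariation (w t)).toReal with hVdef
  have hV0 : 0 ≤ V := ENNReal.toReal_nonneg
  -- the pairings
  set P : d × d → (ℝ → UnitAddTorus d → ℝ) → ℝ := fun p φ =>
    -∫ t, ∫ x, ζ t * (w t x p.1 * Torus.partialDeriv p.2 (φ t) x) with hPdef
  have hPadd : ∀ p {φ ψ : ℝ → UnitAddTorus d → ℝ}, ContDiff ℝ ∞ (Torus.stLift φ) →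
      ContDiff ℝ ∞ (Torus.stLift ψ) → P p (φ + ψ) = P p φ + P p ψ := by
    intro p φ ψ hφ hψ
    simp only [hPdef]
    rw [pairing_add hw hwb hζc hζ1 hζ0 hφ hψ]
    ring
  have hPsmul : ∀ p {φ : ℝ → UnitAddTorus d → ℝ}, ContDiff ℝ ∞ (Torus.stLift φ) → ∀ c : ℝ,
      P p (c • φ) = c * P p φ := by
    intro p φ hφ c
    simp only [hPdef]
    rw [pairing_smul hφ c]
    ring
  have hPsub : ∀ p {φ ψ : ℝ → UnitAddTorus d → ℝ}, ContDiff ℝ ∞ (Torus.stLift φ) →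
      ContDiff ℝ ∞ (Torus.stLift ψ) → P p (φ - ψ) = P p φ - P p ψ := by
    intro p φ ψ hφ hψ
    have h1 : φ - ψ = φ + (-1 : ℝ) • ψ := by
      funext t x
      simp only [Pi.sub_apply, Pi.add_apply, Pi.smul_apply, smul_eq_mul]
      ring
    rw [h1, hPadd p hφ (contDiff_stLift_smul hψ (-1 : ℝ)), hPsmul p hψ]
    ring
  have hPbound : ∀ p {φ : ℝ → UnitAddTorus d → ℝ}, ContDiff ℝ ∞ (Torus.stLift φ) →
      ∀ {S : ℝ}, 0 < S → (∀ t x, |φ t x| ≤ S) → |P p φ| ≤ S * V := by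
    intro p φ hφ S hS hφS
    simp only [hPdef, abs_neg]
    exact abs_pairing_le w hζ1 hζ0 hBV hφ hS (fun t _ x => hφS t x) p.1 p.2
  -- smooth approximations of compactly supported continuous functions
  have happrox : ∀ (f : C_c(ℝ × UnitAddTorus d, ℝ)) (n : ℕ), ∃ χ : ℝ → UnitAddTorus d → ℝ,
      ContDiff ℝ ∞ (Torus.stLift χ) ∧ (∃ a' b' : ℝ, ∀ t ∉ Icc a' b', χ t = 0) ∧
      ∀ t x, |χ t x - f (t, x)| ≤ 1 / ((n : ℝ) + 1) := fun f n =>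
    exists_smooth_near f.continuous f.hasCompactSupport (by positivity)
  choose χ hχs hχsupp hχf using happrox
  have hχdiff : ∀ (f g : C_c(ℝ × UnitAddTorus d, ℝ)) (n m : ℕ) (t : ℝ) (x : UnitAddTorus d),
      |χ f n t x - χ g m t x| ≤ |f (t, x) - g (t, x)| + 1 / ((n : ℝ) + 1) + 1 / ((m : ℝ) + 1) := by
    intro f g n m t x
    have h1 := hχf f n t x
    have h2 := hχf g m t x
    rw [abs_sub_comm] at h2
    calc |χ f n t x - χ g m t x|
        = |(χ f n t x - f (t, x)) + (f (t, x) - g (t, x)) + (g (t, x) - χ g m t x)| := by ring_nf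
      _ ≤ |χ f n t x - f (t, x)| + |f (t, x) - g (t, x)| + |g (t, x) - χ g m t x| :=
          abs_add_three _ _ _
      _ ≤ |f (t, x) - g (t, x)| + 1 / ((n : ℝ) + 1) + 1 / ((m : ℝ) + 1) := by linarith
  -- the sequences `P p (χ f n)` are Cauchy, hence convergent
  have hcauchy : ∀ p f, CauchySeq fun n => P p (χ f n) := by
    intro p f
    refine cauchySeq_of_le_tendsto_0 (fun N : ℕ => (2 / ((N : ℝ) + 1)) * V) (fun n m N hn hm => ?_) ?_
    · rw [Real.dist_eq, ← hPsub p (hχs f n) (hχs f m)]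
      have hS : (0 : ℝ) < 2 / ((N : ℝ) + 1) := by positivity
      refine hPbound p (contDiff_stLift_sub (hχs f n) (hχs f m)) hS fun t x => ?_
      simp only [Pi.sub_apply]
      refine (hχdiff f f n m t x).trans ?_
      rw [sub_self, abs_zero, zero_add]
      have hn' : (N : ℝ) ≤ n := by exact_mod_cast hn
      have hm' : (N : ℝ) ≤ m := by exact_mod_cast hm
      have h1 : 1 / ((n : ℝ) + 1) ≤ 1 / ((N : ℝ) + 1) :=
        one_div_le_one_div_of_le (by positivity) (by linarith)
      have h2 : 1 / ((m : ℝ) + 1) ≤ 1 / ((N : ℝ) + 1) :=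
        one_div_le_one_div_of_le (by positivity) (by linarith)
      have h3 : (2 : ℝ) / ((N : ℝ) + 1) = 1 / ((N : ℝ) + 1) + 1 / ((N : ℝ) + 1) := by ring
      rw [h3]
      exact add_le_add h1 h2
    · have : Tendsto (fun N : ℕ => (2 / ((N : ℝ) + 1)) * V) atTop (𝓝 (0 * V)) := by
        refine Tendsto.mul_const V ?_
        exact tendsto_const_nhds.div_atTop (tendsto_natCast_atTop_atTop.atTop_add
          tendsto_const_nhds)
      simpa using this
  have hlim : ∀ p f, ∃ L : ℝ, Tendsto (fun n => P p (χ f n)) atTop (𝓝 L) := fun p f =>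
    cauchySeq_tendsto_of_complete (hcauchy p f)
  choose L hL using hlim
  -- the key continuity property of `P` along uniformly convergent smooth sequences
  have hPlim : ∀ p (f : C_c(ℝ × UnitAddTorus d, ℝ)) {g : ℕ → ℝ → UnitAddTorus d → ℝ}
      (ε : ℕ → ℝ), (∀ n, ContDiff ℝ ∞ (Torus.stLift (g n))) → (∀ n, 0 < ε n) →
      (∀ n t x, |g n t x - χ f n t x| ≤ ε n) → Tendsto ε atTop (𝓝 0) →
      Tendsto (fun n => P p (g n)) atTop (𝓝 (L p f)) := by
    intro p f g ε hg hε hgχ hε0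
    have hdiff : Tendsto (fun n => P p (g n) - P p (χ f n)) atTop (𝓝 0) := by
      refine squeeze_zero_norm (fun n => ?_) (by simpa using hε0.mul_const V)
      rw [Real.norm_eq_abs, ← hPsub p (hg n) (hχs f n)]
      exact hPbound p (contDiff_stLift_sub (hg n) (hχs f n)) (hε n) fun t x => hgχ n t x
    have := hdiff.add (hL p f)
    simpa using this
  -- `L p` is linear and bounded: the functionals `Λ p`
  have hLadd : ∀ p f g, L p (f + g) = L p f + L p g := by
    intro p f g
    have h1 : Tendsto (fun n => P p (χ f n + χ g n)) atTop (𝓝 (L p (f + g))) := by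
      refine hPlim p (f + g) (fun n => 3 / ((n : ℝ) + 1))
        (fun n => contDiff_stLift_add (hχs f n) (hχs g n))
        (fun n => by positivity) (fun n t x => ?_) ?_
      · have h1 := hχf f n t x
        have h2 := hχf g n t x
        have h3 := hχf (f + g) n t x
        simp only [Pi.add_apply, CompactlySupportedContinuousMap.add_apply] at h3 ⊢
        rw [abs_le] at h1 h2 h3 ⊢
        have : (3 : ℝ) / ((n : ℝ) + 1) = 1 / ((n : ℝ) + 1) + 1 / ((n : ℝ) + 1) + 1 / ((n : ℝ) + 1) := by
          ring
        rw [this]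
        constructor <;> linarith
      · exact tendsto_const_nhds.div_atTop (tendsto_natCast_atTop_atTop.atTop_add
          tendsto_const_nhds)
    have h2 : Tendsto (fun n => P p (χ f n + χ g n)) atTop (𝓝 (L p f + L p g)) := by
      have := (hL p f).add (hL p g)
      refine this.congr fun n => ?_
      exact (hPadd p (hχs f n) (hχs g n)).symm
    exact tendsto_nhds_unique h1 h2
  have hLsmul : ∀ p (c : ℝ) f, L p (c • f) = c * L p f := by
    intro p c f
    have h1 : Tendsto (fun n => P p (c • χ f n)) atTop (𝓝 (L p (c • f))) := by
      refine hPlim p (c • f) (fun n => (|c| + 2) / ((n : ℝ) + 1))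
        (fun n => contDiff_stLift_smul (hχs f n) c)
        (fun n => by positivity) (fun n t x => ?_) ?_
      · have h1 := hχf f n t x
        have h3 := hχf (c • f) n t x
        simp only [Pi.smul_apply, CompactlySupportedContinuousMap.smul_apply, smul_eq_mul] at h3 ⊢
        have e1 : c * χ f n t x - χ (c • f) n t x =
            c * (χ f n t x - f (t, x)) + (c * f (t, x) - χ (c • f) n t x) := by ring
        rw [e1]
        refine (abs_add_le _ _).trans ?_
        rw [abs_mul, add_div, abs_sub_comm (c * f (t, x))]
        refine add_le_add ?_ ?_
        · calc |c| * |χ f n t x - f (t, x)| ≤ |c| * (1 / ((n : ℝ) + 1)) :=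
              mul_le_mul_of_nonneg_left h1 (abs_nonneg c)
            _ = |c| / ((n : ℝ) + 1) := by ring
        · exact h3.trans (div_le_div_of_nonneg_right (by norm_num) (by positivity))
      · exact tendsto_const_nhds.div_atTop (tendsto_natCast_atTop_atTop.atTop_add
          tendsto_const_nhds)
    have h2 : Tendsto (fun n => P p (c • χ f n)) atTop (𝓝 (c * L p f)) := by
      have := (hL p f).const_mul c
      refine this.congr fun n => ?_
      exact (hPsmul p (hχs f n) c).symm
    exact tendsto_nhds_unique h1 h2
  have hLbound : ∀ p (f : C_c(ℝ × UnitAddTorus d, ℝ)) (S : ℝ), (∀ q, |f q| ≤ S) →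
      |L p f| ≤ V * S := by
    intro p f S hS
    have hS0 : 0 ≤ S := (abs_nonneg _).trans (hS (0, 0))
    have h1 : Tendsto (fun n => |P p (χ f n)|) atTop (𝓝 |L p f|) := (hL p f).abs
    have h2 : Tendsto (fun n : ℕ => (S + 1 / ((n : ℝ) + 1)) * V) atTop (𝓝 ((S + 0) * V)) :=
      (tendsto_const_nhds.add (tendsto_const_nhds.div_atTop
        (tendsto_natCast_atTop_atTop.atTop_add tendsto_const_nhds))).mul_const V
    rw [add_zero, mul_comm] at h2
    refine le_of_tendsto_of_tendsto' h1 h2 fun n => ?_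
    refine hPbound p (hχs f n) (by positivity) fun t x => ?_
    have := hχf f n t x
    rw [abs_le] at this ⊢
    have hf := abs_le.1 (hS (t, x))
    constructor <;> linarith
  -- the value on smooth compactly supported functions
  have hLsmooth : ∀ p {φ : ℝ → UnitAddTorus d → ℝ} (hφ : ContDiff ℝ ∞ (Torus.stLift φ))
      (f : C_c(ℝ × UnitAddTorus d, ℝ)), (∀ q, f q = φ q.1 q.2) → L p f = P p φ := by
    intro p φ hφ f hf
    have h1 : Tendsto (fun n : ℕ => P p φ) atTop (𝓝 (L p f)) := by
      refine hPlim p f (fun n => 1 / ((n : ℝ) + 1)) (fun _ => hφ) (fun n => by positivity)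
        (fun n t x => ?_) ?_
      · rw [abs_sub_comm, ← hf (t, x)]
        exact hχf f n t x
      · exact tendsto_const_nhds.div_atTop (tendsto_natCast_atTop_atTop.atTop_add
          tendsto_const_nhds)
    exact tendsto_nhds_unique h1 tendsto_const_nhds
  -- the bounded linear functionals and their Riesz measures
  set Λ : d × d → C_c(ℝ × UnitAddTorus d, ℝ) →ₗ[ℝ] ℝ := fun p =>
    { toFun := L p
      map_add' := hLadd p
      map_smul' := fun c f => by
        rw [RingHom.id_apply, smul_eq_mul]
        exact hLsmul p c f } with hΛdef
  have hΛapply : ∀ p f, Λ p f = L p f := fun p f => rfl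
  have hex : ∀ p, ∃ μ₁ μ₂ : Measure (ℝ × UnitAddTorus d), μ₁.Regular ∧ μ₂.Regular ∧
      μ₁ univ ≤ ENNReal.ofReal (2 * V) ∧ μ₂ univ ≤ ENNReal.ofReal (2 * V) ∧
      ∀ f : C_c(ℝ × UnitAddTorus d, ℝ), 2 * Λ p f = (∫ q, f q ∂μ₁) - ∫ q, f q ∂μ₂ := fun p =>
    exists_measure_sub_measure_of_bounded (Λ p) fun f S hS => by
      rw [hΛapply]
      exact hLbound p f S hS
  choose μ₁ μ₂ hμ₁r hμ₂r hμ₁b hμ₂b hΛμ using hex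
  have hfin₁ : ∀ p, IsFiniteMeasure (μ₁ p) := fun p =>
    ⟨(hμ₁b p).trans_lt ENNReal.ofReal_lt_top⟩
  have hfin₂ : ∀ p, IsFiniteMeasure (μ₂ p) := fun p =>
    ⟨(hμ₂b p).trans_lt ENNReal.ofReal_lt_top⟩
  -- the dominating measure and the densities
  set μ : Measure (ℝ × UnitAddTorus d) := ∑ p : d × d, (μ₁ p + μ₂ p) with hμdef
  haveI hμfin : IsFiniteMeasure μ := by
    refine ⟨?_⟩
    rw [hμdef, Measure.finsetSum_apply]
    refine ENNReal.sum_lt_top.2 fun p _ => ?_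
    rw [Measure.add_apply]
    exact ENNReal.add_lt_top.2 ⟨measure_lt_top _ _, measure_lt_top _ _⟩
  have hle₁ : ∀ p, μ₁ p ≤ μ := fun p => by
    rw [hμdef]
    exact le_trans (Measure.le_add_right le_rfl)
      (Finset.single_le_sum (f := fun p => μ₁ p + μ₂ p) (fun q _ => Measure.zero_le _)
        (Finset.mem_univ p))
  have hle₂ : ∀ p, μ₂ p ≤ μ := fun p => by
    rw [hμdef]
    exact le_trans (Measure.le_add_left le_rfl)
      (Finset.single_le_sum (f := fun p => μ₁ p + μ₂ p) (fun q _ => Measure.zero_le _)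
        (Finset.mem_univ p))
  have hac₁ : ∀ p, μ₁ p ≪ μ := fun p => Measure.absolutelyContinuous_of_le (hle₁ p)
  have hac₂ : ∀ p, μ₂ p ≪ μ := fun p => Measure.absolutelyContinuous_of_le (hle₂ p)
  set r₁ : d × d → ℝ × UnitAddTorus d → ℝ := fun p q => min 1 ((μ₁ p).rnDeriv μ q).toReal
    with hr₁def
  set r₂ : d × d → ℝ × UnitAddTorus d → ℝ := fun p q => min 1 ((μ₂ p).rnDeriv μ q).toReal
    with hr₂def
  have hr₁m : ∀ p, Measurable (r₁ p) := fun p =>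
    measurable_const.min (Measure.measurable_rnDeriv _ _).ennreal_toReal
  have hr₂m : ∀ p, Measurable (r₂ p) := fun p =>
    measurable_const.min (Measure.measurable_rnDeriv _ _).ennreal_toReal
  have hr₁ae : ∀ p, r₁ p =ᵐ[μ] fun q => ((μ₁ p).rnDeriv μ q).toReal := fun p => by
    filter_upwards [Measure.rnDeriv_le_one_of_le (hle₁ p)] with q hq
    simp only [hr₁def]
    exact min_eq_right (ENNReal.toReal_le_of_le_ofReal zero_le_one (by simpa using hq))
  have hr₂ae : ∀ p, r₂ p =ᵐ[μ] fun q => ((μ₂ p).rnDeriv μ q).toReal := fun p => by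
    filter_upwards [Measure.rnDeriv_le_one_of_le (hle₂ p)] with q hq
    simp only [hr₂def]
    exact min_eq_right (ENNReal.toReal_le_of_le_ofReal zero_le_one (by simpa using hq))
  have hr₁b : ∀ p q, |r₁ p q| ≤ 1 := fun p q => by
    simp only [hr₁def]
    rw [abs_of_nonneg (le_min zero_le_one ENNReal.toReal_nonneg)]
    exact min_le_left _ _
  have hr₂b : ∀ p q, |r₂ p q| ≤ 1 := fun p q => by
    simp only [hr₂def]
    rw [abs_of_nonneg (le_min zero_le_one ENNReal.toReal_nonneg)]
    exact min_le_left _ _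
  set m : d × d → ℝ × UnitAddTorus d → ℝ := fun p q => 2⁻¹ * (r₁ p q - r₂ p q) with hmdef
  have hmm : ∀ p, Measurable (m p) := fun p => ((hr₁m p).sub (hr₂m p)).const_mul _
  have hmb : ∀ p q, |m p q| ≤ 1 := fun p q => by
    simp only [hmdef]
    rw [abs_mul, abs_of_pos (by norm_num : (0 : ℝ) < 2⁻¹)]
    have := abs_sub (r₁ p q) (r₂ p q)
    linarith [hr₁b p q, hr₂b p q]
  -- representation of `Λ p` by the density `m p`
  have hrep : ∀ p (f : C_c(ℝ × UnitAddTorus d, ℝ)), Λ p f = ∫ q, f q * m p q ∂μ := by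
    intro p f
    haveI := hfin₁ p
    haveI := hfin₂ p
    have h2 := hΛμ p f
    rw [← integral_toReal_rnDeriv_mul (hac₁ p), ← integral_toReal_rnDeriv_mul (hac₂ p)] at h2
    have hi₁ : Integrable (fun q => ((μ₁ p).rnDeriv μ q).toReal * f q) μ :=
      Measure.integrable_toReal_rnDeriv.mul_bdd f.continuous.aestronglyMeasurable
        (ae_of_all _ (f.continuous.bounded_above_of_compact_support f.hasCompactSupport).choose_spec)
    have hi₂ : Integrable (fun q => ((μ₂ p).rnDeriv μ q).toReal * f q) μ :=
      Measure.integrable_toReal_rnDeriv.mul_bdd f.continuous.aestronglyMeasurable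
        (ae_of_all _ (f.continuous.bounded_above_of_compact_support f.hasCompactSupport).choose_spec)
    rw [← integral_sub hi₁ hi₂] at h2
    have h3 : ∫ q, f q * m p q ∂μ =
        ∫ q, 2⁻¹ * (((μ₁ p).rnDeriv μ q).toReal * f q - ((μ₂ p).rnDeriv μ q).toReal * f q) ∂μ := by
      refine integral_congr_ae ?_
      filter_upwards [hr₁ae p, hr₂ae p] with q h1 h2
      simp only [hmdef]
      rw [h1, h2]
      ring
    rw [h3, integral_const_mul, ← h2]
    ring
  -- the matrix field
  set Eop : d × d → EuclideanSpace ℝ d →L[ℝ] EuclideanSpace ℝ d := fun p =>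
    (EuclideanSpace.proj p.2).smulRight (EuclideanSpace.single p.1 (1 : ℝ)) with hEdef
  set M : ℝ × UnitAddTorus d → EuclideanSpace ℝ d →L[ℝ] EuclideanSpace ℝ d := fun q =>
    ∑ p : d × d, m p q • Eop p with hMdef
  have hMmeas : StronglyMeasurable M := by
    refine Finset.stronglyMeasurable_fun_sum _ fun p _ => ?_
    exact (hmm p).stronglyMeasurable.smul_const _
  have hMnorm : ∀ q, ‖M q‖ ≤ (Fintype.card d : ℝ) ^ 2 := by
    intro q
    calc ‖M q‖ ≤ ∑ p : d × d, ‖m p q • Eop p‖ := norm_sum_le _ _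
      _ ≤ ∑ p : d × d, (1 : ℝ) := by
          refine Finset.sum_le_sum fun p _ => ?_
          rw [norm_smul, Real.norm_eq_abs]
          exact mul_le_one₀ (hmb p q) (norm_nonneg _) (norm_smulRight_single_le p.1 p.2)
      _ = (Fintype.card d : ℝ) ^ 2 := by simp [sq]
  have hMinner : ∀ q e z, ⟪e, M q z⟫ = ∑ p : d × d, m p q * (e p.1 * z p.2) := by
    intro q e z
    simp only [hMdef, _root_.sum_apply, inner_sum, FunLike.coe_smul,
      Pi.smul_apply, real_inner_smul_right, hEdef, inner_smulRight_single_apply]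
  -- representation of the pairings against smooth functions
  have hPrep : ∀ p {φ : ℝ → UnitAddTorus d → ℝ}, ContDiff ℝ ∞ (Torus.stLift φ) →
      (∃ a' b' : ℝ, ∀ t ∉ Icc a' b', φ t = 0) → P p φ = ∫ q, φ q.1 q.2 * m p q ∂μ := by
    intro p φ hφ hφsupp
    obtain ⟨a', b', hab'⟩ := hφsupp
    obtain ⟨f, hf⟩ := exists_compactlySupported_eq hφ hab'
    rw [← hLsmooth p hφ f hf, ← hΛapply, hrep p f]
    refine integral_congr_ae (ae_of_all _ fun q => ?_)
    dsimp only
    rw [hf q]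
  refine ⟨μ, M, hμfin, hMmeas, hMnorm, ?_, ?_⟩
  · -- trace-free: `∑ᵢ mᵢᵢ = 0` a.e. by `div w = 0` and the du Bois-Reymond lemma
    have htr : ∀ q, LinearMap.trace ℝ (EuclideanSpace ℝ d)
        (M q : EuclideanSpace ℝ d →ₗ[ℝ] EuclideanSpace ℝ d) = ∑ i, m (i, i) q := fun q =>
      trace_sum_smul_smulRight (fun p => m p q) (M q) rfl
    simp_rw [htr]
    have hint : Integrable (fun q => ∑ i, m (i, i) q) μ := by
      refine Integrable.of_bound ?_ (Fintype.card d : ℝ) (ae_of_all _ fun q => ?_)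
      · exact (Finset.aestronglyMeasurable_fun_sum _ fun i _ =>
          (hmm (i, i)).aestronglyMeasurable)
      · refine (norm_sum_le _ _).trans ?_
        calc ∑ i, ‖m (i, i) q‖ ≤ ∑ _i : d, (1 : ℝ) :=
              Finset.sum_le_sum fun i _ => by rw [Real.norm_eq_abs]; exact hmb _ _
          _ = Fintype.card d := by simp
    have h := ae_eq_zero_of_forall_smooth_integral_eq_zero hint fun θ hθ hθsupp => ?_
    · filter_upwards [h] with q hq
      simpa using hq
    -- `∫ θ ∑ᵢ mᵢᵢ dμ = ∑ᵢ P (i,i) θ = -∫ ζ ∫ ⟪w, ∇θ⟫ = 0`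
    show ∫ q, θ q.1 q.2 * ∑ i, m (i, i) q ∂μ = 0
    obtain ⟨hθc, Cθ, hCθ⟩ := continuous_uncurry_and_bounded hθ hθsupp.choose_spec.choose_spec
    have hsum : ∫ q, θ q.1 q.2 * ∑ i, m (i, i) q ∂μ = ∑ i, P (i, i) θ := by
      simp_rw [Finset.mul_sum]
      rw [integral_finsetSum _ fun i _ => ?_]
      · exact Finset.sum_congr rfl fun i _ => (hPrep (i, i) hθ hθsupp).symm
      · exact (Integrable.of_bound (μ := μ) (hmm (i, i)).aestronglyMeasurable 1
          (ae_of_all _ fun q => by rw [Real.norm_eq_abs]; exact hmb _ _)).bdd_mul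
          hθc.aestronglyMeasurable (ae_of_all _ fun q => hCθ q)
    rw [hsum]
    simp only [hPdef]
    rw [Finset.sum_neg_distrib, neg_eq_zero]
    rw [← integral_finsetSum _ fun i _ => integrable_pairing_time hw hwb hζc hζ1 hζ0 hθ i i]
    refine integral_eq_zero_of_ae ?_
    have hdiv' : ∀ᵐ t ∂(volume : Measure ℝ), t ∈ Icc a b → Torus.IsWeaklyDivFree (w t) :=
      (ae_restrict_iff' measurableSet_Icc).1 hdiv
    filter_upwards [hdiv'] with t ht
    show ∑ i, ∫ x, ζ t * (w t x i * Torus.partialDeriv i (θ t) x) = 0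
    by_cases htI : t ∈ Icc a b
    · have hWD := ht htI (θ t) (isSmooth_slice hθ t)
      rw [← integral_finsetSum _ fun i _ => integrable_pairing_slice hw hwb hθ i i t]
      have : (fun x => ∑ i, ζ t * (w t x i * Torus.partialDeriv i (θ t) x)) =
          fun x => ζ t * ⟪w t x, Torus.gradient (θ t) x⟫ := by
        funext x
        rw [inner_gradient_eq_sum ((isSmooth_slice hθ t).isContDiff (by simp)), Finset.mul_sum]
      rw [this, integral_const_mul, hWD, mul_zero]
    · simp [hζ0 t htI]
  · -- the representation formula
    intro φ hφ hφsupp e z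
    have hslice : ∀ t, Torus.IsContDiff 1 (φ t) := fun t => (isSmooth_slice hφ t).isContDiff (by simp)
    obtain ⟨hφc, Cφ, hCφ⟩ := continuous_uncurry_and_bounded hφ hφsupp.choose_spec.choose_spec
    -- left-hand side: expand in coordinates and pull out the finite sums
    have hexp : ∀ t x, ζ t * (⟪e, w t x⟫ * Torus.fderiv (φ t) x z) =
        ∑ p : d × d, (e p.1 * z p.2) * (ζ t * (w t x p.1 * Torus.partialDeriv p.2 (φ t) x)) :=
      fun t x => mul_inner_mul_fderiv_eq_sum (hslice t) _ _ _ _ _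
    have hL : -∫ t, ∫ x, ζ t * (⟪e, w t x⟫ * Torus.fderiv (φ t) x z) =
        ∑ p : d × d, (e p.1 * z p.2) * P p φ := by
      have hin : ∀ t, ∫ x, ζ t * (⟪e, w t x⟫ * Torus.fderiv (φ t) x z) =
          ∑ p : d × d, (e p.1 * z p.2) * ∫ x, ζ t * (w t x p.1 * Torus.partialDeriv p.2 (φ t) x) := by
        intro t
        simp_rw [hexp]
        rw [integral_finsetSum _ fun p _ =>
          (integrable_pairing_slice hw hwb hφ p.1 p.2 t).const_mul (e p.1 * z p.2)]
        exact Finset.sum_congr rfl fun p _ => integral_const_mul _ _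
      simp_rw [hin]
      rw [integral_finsetSum _ fun p _ =>
        (integrable_pairing_time hw hwb hζc hζ1 hζ0 hφ p.1 p.2).const_mul (e p.1 * z p.2)]
      simp only [hPdef]
      rw [← Finset.sum_neg_distrib]
      refine Finset.sum_congr rfl fun p _ => ?_
      rw [integral_const_mul]
      ring
    -- right-hand side
    have hint : ∀ p, Integrable (fun q : ℝ × UnitAddTorus d => φ q.1 q.2 * m p q) μ := fun p =>
      (Integrable.of_bound (μ := μ) (hmm p).aestronglyMeasurable 1
        (ae_of_all _ fun q => by rw [Real.norm_eq_abs]; exact hmb _ _)).bdd_mul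
        hφc.aestronglyMeasurable (ae_of_all _ fun q => hCφ q)
    have hR : ∫ q, φ q.1 q.2 * ⟪e, M q z⟫ ∂μ = ∑ p : d × d, (e p.1 * z p.2) * P p φ := by
      have hexp2 : ∀ q, φ q.1 q.2 * ⟪e, M q z⟫ =
          ∑ p : d × d, (e p.1 * z p.2) * (φ q.1 q.2 * m p q) := by
        intro q
        rw [hMinner, Finset.mul_sum]
        exact Finset.sum_congr rfl fun p _ => by ring
      simp_rw [hexp2]
      rw [integral_finsetSum _ fun p _ => (hint p).const_mul (e p.1 * z p.2)]
      refine Finset.sum_congr rfl fun p _ => ?_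
      rw [integral_const_mul, hPrep p hφ hφsupp]
    rw [hL, hR]

end CodimensionOneRigidity

end Literature.Barriers.AnomalousDissipation

end
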